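import Literature.AlgebraicGeometry.Resolution.LocalBlowup
import HarnessLib

/-!
# Local blowing ups along stable ideals are stable ([CoP1] Lemma 9.4: "`S` is stable by `G`")

Topic: `Literature/AlgebraicGeometry/Resolution`. PROOF side of `CossartPiltant2019ReductionP`
(`ArithmeticalThreefoldsLocal.lean`), input (C4) — descent of local uniformization below the
ramification field ([CoP1] Props. 9.3/9.5 with Lemma 9.4). The toric descent step
(`TameCyclicToricDescent.lean`) starts from a REGULAR local model upstairs that is STABLE under
the Galois automorphism `σ`; the source asserts this in one sentence ("Also `S` is stable by `G`,
since any conjugate of `S` is dominated by `W`, hence equal to `S`", HAL p. 29), which does not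
hold for an arbitrary local uniformization (memo `Sketch-memo-hand1-g7.md` §2 (α) of the
`CleanModels` crux). What IS true, and is the tool for producing stable models by blowing up, is
proved here: a local blowing up (Novacoski–Spivakovsky 2014, Def. 2.11; `LocalBlowup.lean`,
`IsLocalBlowupAlong`) of a `σ`-stable subring `B ⊆ O` along a `σ`-stable ideal `I`, with respect
to a `σ`-stable valuation ring `O`, is again `σ`-stable — the chart of the blowing up containing
the centre of `O` does not depend on the chosen generator of minimal value.

* `IsLocalBlowupAlong.map_mem_of_stable` — PROVED.
* `locAtCentre_map_mem_of_stable` — PROVED: local rings at the centre of `σ`-stable subrings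
  are `σ`-stable; `closure_union_orbit_stable` — PROVED: orbit algebras
  `B[t, σt, …, σ^{ℓ-1}t]` are `σ`-stable (the singular stable models any repair starts from).

Everything is PROVED; no named facts are introduced.

## Sources

* V. Cossart, O. Piltant, *Resolution of singularities of threefolds in positive characteristic.
  I*, J. Algebra 320 (2008) 1051–1082: proof of Lemma 9.4 (HAL hal-00139124, p. 29, "`S` is
  stable by `G`"). [CossartPiltant2008]
* J. Novacoski, M. Spivakovsky, *Reduction of local uniformization to the rank one case*,
  Valuation theory in interaction, EMS (2014): Def. 2.11. [NovacoskiSpivakovsky2014]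
-/

noncomputable section

namespace Literature.AlgebraicGeometry.Resolution

universe u

variable {K : Type u} [Field K] {O : ValuationSubring K}

/-- **A local blowing up along a stable ideal is stable.** Let `σ` be an automorphism of the
field `K` with `σ O ⊆ O` for the valuation ring `O`, `B ⊆ O` a subring with `σ B = B`, `I` an
ideal of `B` with `σ I = I`, and `B' = (B[I/u₀])_{𝔪_O ∩ B[I/u₀]}` the local blowing up of `B`
along `I` with respect to `O` (`u₀ ∈ I` a generator of minimal value). Then `σ B' ⊆ B'`: for a
generator `x` of `I`, `σ(x/u₀) = (σx/u₀) · (u₀/σu₀)` with `σx/u₀ ∈ B[I/u₀]` and `σu₀/u₀` a unit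
of `O` lying in `B[I/u₀]`, hence a unit of `B'`. (The correct kernel behind [CoP1] Lemma 9.4,
"`S` is stable by `G`": stability is inherited along blowing ups of stable ideals.)
[cite: CossartPiltant2008, proof of Lemma 9.4 (HAL p. 29), "S is stable by G"]
[cite: NovacoskiSpivakovsky2014, Def. 2.11] -/
theorem IsLocalBlowupAlong.map_mem_of_stable (σ : K ≃+* K)
    (hσO : ∀ z ∈ O, σ z ∈ O)
    {B : Subring K} {I : Ideal B} {B' : Subring K} (H : IsLocalBlowupAlong O B I B')
    (hσB : ∀ b ∈ B, σ b ∈ B) (hσB' : ∀ b ∈ B, σ.symm b ∈ B)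
    (hσI : ∀ x : B, x ∈ I → (⟨σ x, hσB x x.2⟩ : B) ∈ I)
    (hσI' : ∀ x : B, x ∈ I → (⟨σ.symm x, hσB' x x.2⟩ : B) ∈ I) :
    ∀ z ∈ B', σ z ∈ B' := by
  classical
  obtain ⟨hB, u, u₀, hu, hu₀, h0, hval, rfl⟩ := H
  have h0' : ((u₀ : B) : K) ≠ 0 := fun e => h0 (Subtype.ext e)
  set C := Subring.closure ((B : Set K) ∪ (fun x : B => (x : K) / u₀) '' ↑u) with hC
  -- `C ⊆ O`
  have hCO : C ≤ O.toSubring := by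
    refine Subring.closure_le.mpr (Set.union_subset hB ?_)
    rintro _ ⟨x, hx, rfl⟩
    have hvu₀ : O.valuation ((u₀ : B) : K) ≠ 0 := (Valuation.ne_zero_iff _).mpr h0'
    change (x : K) / u₀ ∈ O
    rw [← O.valuation_le_one_iff, map_div₀, div_le_one₀ (zero_lt_iff.mpr hvu₀)]
    exact hval x hx
  have hBC : ∀ b ∈ B, b ∈ C := fun b hb => Subring.subset_closure (Or.inl hb)
  -- every element of `I`, divided by `u₀`, lies in `C`
  have key : ∀ x ∈ I, (x : K) / u₀ ∈ C := by
    intro x hx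
    rw [← hu] at hx
    induction hx using Submodule.span_induction with
    | mem x hx => exact Subring.subset_closure (Or.inr ⟨x, hx, rfl⟩)
    | zero => simp
    | add x y _ _ hx hy => rw [Subring.coe_add, add_div]; exact C.add_mem hx hy
    | smul a x _ hx =>
      rw [smul_eq_mul, Subring.coe_mul, mul_div_assoc]
      exact C.mul_mem (hBC _ a.2) hx
  have hu₀I : u₀ ∈ I := hu ▸ Ideal.subset_span hu₀
  -- `w = σu₀/u₀ ∈ C` is a unit of `O`
  set w : K := σ u₀ / u₀ with hw
  have hwC : w ∈ C := key _ (hσI u₀ hu₀I)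
  have hσu₀0 : σ ((u₀ : B) : K) ≠ 0 := fun e => h0' (by simpa using congrArg σ.symm e)
  have hwinvO : w⁻¹ ∈ O := by
    -- `u₀/σu₀ = σ (σ⁻¹u₀ / u₀)` and `σ⁻¹u₀/u₀ ∈ C ⊆ O`
    have h1 : (σ.symm u₀ : K) / u₀ ∈ O := hCO (key _ (hσI' u₀ hu₀I))
    have h2 : σ ((σ.symm u₀ : K) / u₀) = w⁻¹ := by
      rw [map_div₀, σ.apply_symm_apply, hw, inv_div]
    rw [← h2]; exact hσO _ h1
  have hwv : O.valuation w = 1 := by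
    refine le_antisymm ((O.valuation_le_one_iff _).mpr (hCO hwC)) ?_
    have hw0 : w ≠ 0 := div_ne_zero hσu₀0 h0'
    have h := (O.valuation_le_one_iff _).mpr hwinvO
    rw [map_inv₀, inv_le_one₀ ((Valuation.pos_iff _).mpr hw0)] at h
    exact h
  have hwinv : w⁻¹ ∈ locAtCentre C O := inv_mem_locAtCentre (le_locAtCentre C O hwC) hwv
  -- `σ` maps the generators of `C`, hence `C`, into `B' = locAtCentre C O`
  have hσC : ∀ c ∈ C, σ c ∈ locAtCentre C O := by
    have hle : C ≤ (locAtCentre C O).comap σ.toRingHom := by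
      refine Subring.closure_le.mpr ?_
      rintro c (hc | ⟨x, hx, rfl⟩)
      · exact le_locAtCentre C O (hBC _ (hσB c hc))
      · -- `σ(x/u₀) = (σx/u₀) · w⁻¹`
        change σ ((x : K) / u₀) ∈ locAtCentre C O
        have hxI : x ∈ I := hu ▸ Ideal.subset_span hx
        have h1 : σ ((x : K) / u₀) = (σ x / u₀) * w⁻¹ := by
          rw [map_div₀, hw, inv_div]
          field_simp
        rw [h1]
        exact Subring.mul_mem _ (le_locAtCentre C O (key _ (hσI x hxI))) hwinv
    intro c hc
    exact hle hc
  -- units of `O` stay units of `O`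
  have hσunit : ∀ s ∈ C, O.valuation s = 1 → O.valuation (σ s) = 1 := by
    intro s hs hs1
    have hs0 : s ≠ 0 := ne_zero_of_valuation_eq_one hs1
    refine le_antisymm ((O.valuation_le_one_iff _).mpr (hσO _ (hCO hs))) ?_
    have hsinv : s⁻¹ ∈ O := by
      rw [← O.valuation_le_one_iff, map_inv₀, hs1, inv_one]
    have h := (O.valuation_le_one_iff _).mpr (hσO _ hsinv)
    rw [map_inv₀, map_inv₀, inv_le_one₀ ((Valuation.pos_iff _).mpr
      (fun e => hs0 (by simpa using congrArg σ.symm e)))] at h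
    exact h
  -- conclusion
  intro z hz
  obtain ⟨y, hy, s, hs, hsv, rfl⟩ := mem_locAtCentre_iff.mp hz
  rw [map_div₀, div_eq_mul_inv]
  exact Subring.mul_mem _ (hσC y hy) (inv_mem_locAtCentre (hσC s hs) (hσunit s hs hsv))

/-- **Local rings at the centre of stable subrings are stable**: if `σ O ⊆ O` and `σ C ⊆ C` for a
subring `C ⊆ O`, then `σ` maps `C_{𝔪_O ∩ C} = locAtCentre C O` into itself (a unit of `O` in `C`
stays a unit of `O`). With `C = B[t, σt, …, σ^{ℓ-1}t]` this gives the `σ`-stable (possibly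
singular) local models from which an equivariant repair of [CoP1] Lemma 9.4 "`S` is stable by
`G`" has to start. [cite: CossartPiltant2008, proof of Lemma 9.4 (HAL p. 29), "S is stable by G"]
[cite: NovacoskiSpivakovsky2014, Def. 2.8] -/
theorem locAtCentre_map_mem_of_stable (σ : K ≃+* K) (hσO : ∀ z ∈ O, σ z ∈ O)
    {C : Subring K} (hCO : C ≤ O.toSubring) (hσC : ∀ c ∈ C, σ c ∈ C) :
    ∀ z ∈ locAtCentre C O, σ z ∈ locAtCentre C O := by
  have hσunit : ∀ s ∈ C, O.valuation s = 1 → O.valuation (σ s) = 1 := by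
    intro s hs hs1
    have hs0 : s ≠ 0 := ne_zero_of_valuation_eq_one hs1
    refine le_antisymm ((O.valuation_le_one_iff _).mpr (hσO _ (hCO hs))) ?_
    have hsinv : s⁻¹ ∈ O := by
      rw [← O.valuation_le_one_iff, map_inv₀, hs1, inv_one]
    have h := (O.valuation_le_one_iff _).mpr (hσO _ hsinv)
    rw [map_inv₀, map_inv₀, inv_le_one₀ ((Valuation.pos_iff _).mpr
      (fun e => hs0 (by simpa using congrArg σ.symm e)))] at h
    exact h
  intro z hz
  obtain ⟨y, hy, s, hs, hsv, rfl⟩ := mem_locAtCentre_iff.mp hz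
  exact mem_locAtCentre_iff.mpr ⟨σ y, hσC y hy, σ s, hσC s hs, hσunit s hs hsv, map_div₀ σ y s⟩

/-- **The orbit algebra is stable**: for `σ` with `σ^ℓ = 1`, the subring generated by a
`σ`-stable set `X` together with the `σ`-orbits `{σⁱ t}` of finitely many further elements is
`σ`-stable — e.g. `B[t, σt, …, σ^{ℓ-1}t]` for a `σ`-stable `B` (the conjugates of a model
"dominated by `W`", [CoP1] proof of Lemma 9.4, generate a stable one).
[cite: CossartPiltant2008, proof of Lemma 9.4 (HAL p. 29), "any conjugate of S is dominated by W"] -/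
theorem closure_union_orbit_stable (σ : K ≃+* K) {ℓ : ℕ} (hℓ0 : ℓ ≠ 0) (hσℓ : σ ^ ℓ = 1)
    (X : Set K) (hX : ∀ x ∈ X, σ x ∈ X) (t : Finset K) :
    ∀ z ∈ Subring.closure (X ∪ ((fun p : ℕ × K => (σ ^ p.1) p.2) ''
        ((Finset.range ℓ ×ˢ t : Finset (ℕ × K)) : Set (ℕ × K)))),
      σ z ∈ Subring.closure (X ∪ ((fun p : ℕ × K => (σ ^ p.1) p.2) ''
        ((Finset.range ℓ ×ˢ t : Finset (ℕ × K)) : Set (ℕ × K)))) := by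
  classical
  set Y : Set K := (fun p : ℕ × K => (σ ^ p.1) p.2) ''
    ((Finset.range ℓ ×ˢ t : Finset (ℕ × K)) : Set (ℕ × K)) with hY
  set C := Subring.closure (X ∪ Y) with hC
  have hle : C ≤ C.comap σ.toRingHom := by
    refine Subring.closure_le.mpr ?_
    rintro z (hz | ⟨⟨i, x⟩, hp, rfl⟩)
    · exact Subring.subset_closure (Or.inl (hX z hz))
    · obtain ⟨hi, hx⟩ := Finset.mem_product.mp (Finset.mem_coe.mp hp)
      change σ ((σ ^ i) x) ∈ C
      have h1 : σ ((σ ^ i) x) = (σ ^ ((i + 1) % ℓ)) x := by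
        rw [← RingAut.mul_apply, ← pow_succ']
        conv_lhs => rw [← Nat.mod_add_div (i + 1) ℓ, pow_add, pow_mul, hσℓ, one_pow, mul_one]
      rw [h1]
      refine Subring.subset_closure (Or.inr ⟨⟨(i + 1) % ℓ, x⟩, ?_, rfl⟩)
      exact Finset.mem_coe.mpr (Finset.mem_product.mpr
        ⟨Finset.mem_range.mpr (Nat.mod_lt _ (Nat.pos_of_ne_zero hℓ0)), hx⟩)
  intro z hz
  exact hle hz

end Literature.AlgebraicGeometry.Resolution

end
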